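import Summits.BirchSwinnertonDyer.BirchSwinnertonDyer.Theorems.SignedLowerHalvesSmallImageLowerHalfBothSignsLambdaLowerThreeNsThetaPartnerLevelMatchDichotomy
import Literature.NumberTheory.GaloisRepresentations.ArtinConductorWildProofs
import HarnessLib

/-!
# Wild inertia acts through elements of `ℓ`-power order on any `λ`-adic representation, `λ ∤ ℓ`
# (brick LM-F of `stub_levelMatch_ns`)

Route `SignedLowerHalves`, child L `SmallImageLowerHalfBothSigns` (item stmt-BirchSwinnertonDyer-23599), line `rtt_w3`
(skeleton of record v2, stub `stub_levelMatch_ns`; width seat `bsd-line-slh-p3-w3` gen 10; memo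
`Lines/birth_acns-MEMO-w3-g10.md` §4).  THEOREMS ONLY (no definition, no named fact, no `sorry`); ROUTE-INDEPENDENT.

Katz's remark behind "finite wild image" (*Gauss sums, Kloosterman sums, and monodromy groups*, 1.8), in the
ELEMENTWISE form the level clause needs and for coefficients in ANY ultrametric normed field `E` with `‖ℓ‖_E = 1`
(so `E = ℚ̄_p`, `p ≠ ℓ`, is allowed — no finiteness of `[E : ℚ_p]` is used):

* `Matrix.exists_pow_prime_pow_eq_one_of_tendsto` — a square matrix `A` over `E` with `A^{ℓ^k} → 1` satisfies
  `A^{ℓ^k} = 1` for some `k` (the tree's `UltrametricMatrix.eq_one_of_tendsto_pow_pow`: once `‖A^{ℓ^{k₁}} - 1‖ < 1`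
  the distances `‖A^{ℓ^{k₁+j}} - 1‖` are constant);
* `FramedRep.exists_pow_prime_pow_eq_one_of_tendsto`, `ContinuousRep.exists_pow_prime_pow_eq_one_of_tendsto` —
  hence a continuous (framed or finite-dimensional linear) representation sends every `σ` with `σ^{ℓ^k} → 1` to an
  element of `ℓ`-power order;
* `FramedGaloisRep.exists_pow_prime_pow_eq_one_of_mem_absUpperRamificationSubgroup`,
  `GaloisRep.exists_pow_prime_pow_eq_one_of_mem_absUpperRamificationSubgroup` — in particular every element of a
  ramification group `Γ_K^u`, `u > 0`, at a prime `𝔓 ∋ ℓ` (the tree's `GaloisRep.tendsto_pow_pow_of_mem_closure`: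
  the wild closure is pro-`ℓ`);
* `ContinuousRep.fixedSubmodule_eq_bot_or_eq_top_of_forall_exists_pow`,
  `FramedRep.fixedSubmodule_eq_bot_or_eq_top_of_forall_exists_pow` — the dichotomy of brick LM-B with the exponent
  allowed to depend on the element (which is what the bullets above deliver).

BSD, crux L and the stub are NOT proved here.

References: N. M. Katz, *Gauss sums, Kloosterman sums, and monodromy groups* (1988), Ch. 1, 1.8 and Remark 1.10;
J.-P. Serre, Corps locaux IV §2 Cor. 3; folklore.
-/

set_option autoImplicit false
set_option linter.dupNamespace false

noncomputable section

open scoped MatrixGroups NumberField Matrix.Norms.Elementwise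
open Module Matrix Filter Topology

namespace Summit.BirchSwinnertonDyer.BirchSwinnertonDyer.Theorems.SmallImageLambdaLowerThreeNsThetaPartner

open Literature.NumberTheory.GaloisRepresentations

/-! ### Matrices: `A^{ℓ^k} → 1` forces `A^{ℓ^k} = 1` eventually -/

section Matrices

variable {E : Type*} [NormedField E] [IsUltrametricDist E] {n : Type*} [Fintype n] [DecidableEq n]

/-- **Katz 1.8, elementwise.**  Over an ultrametric normed field with `‖ℓ‖ = 1`, a square matrix whose `ℓ^k`-th powers
tend to `1` has some `ℓ^k`-th power EQUAL to `1`. [cite: Katz1988, Ch. 1, 1.8 and Remark 1.10] -/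
theorem Matrix.exists_pow_prime_pow_eq_one_of_tendsto {ℓ : ℕ} (hℓ : ‖(ℓ : E)‖ = 1) {A : Matrix n n E}
    (hlim : Tendsto (fun k : ℕ => A ^ (ℓ ^ k)) atTop (𝓝 1)) : ∃ k : ℕ, A ^ (ℓ ^ k) = 1 := by
  have hev : ∀ᶠ k : ℕ in atTop, dist (A ^ (ℓ ^ k)) 1 < 1 := Metric.tendsto_nhds.mp hlim 1 one_pos
  obtain ⟨k₁, hk₁⟩ := hev.exists
  refine ⟨k₁, UltrametricMatrix.eq_one_of_tendsto_pow_pow hℓ (by rwa [dist_eq_norm] at hk₁) ?_⟩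
  have hshift : Tendsto (fun j : ℕ => A ^ (ℓ ^ (j + k₁))) atTop (𝓝 1) := hlim.comp (tendsto_add_atTop_nat k₁)
  refine hshift.congr fun j => ?_
  rw [← pow_mul, ← pow_add, Nat.add_comm]

end Matrices

/-! ### Continuous representations: elements with `σ^{ℓ^k} → 1` act through `ℓ`-power order -/

section Representations

variable {G : Type*} [Group G] [TopologicalSpace G] {E : Type*} [NormedField E] [IsUltrametricDist E]

/-- **Framed form.**  For a continuous `ρ : G →ₜ* GL_n(E)` (`E` ultrametric, `‖ℓ‖_E = 1`) and `σ ∈ G` with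
`σ^{ℓ^k} → 1`: `ρ(σ)^{ℓ^k} = 1` for some `k`. [cite: Katz1988, Ch. 1, 1.8 and Remark 1.10] -/
theorem FramedRep.exists_pow_prime_pow_eq_one_of_tendsto {n : ℕ} (ρ : FramedRep G E n) {ℓ : ℕ} (hℓ : ‖(ℓ : E)‖ = 1)
    {σ : G} (hσ : Tendsto (fun k : ℕ => σ ^ (ℓ ^ k)) atTop (𝓝 1)) : ∃ k : ℕ, ρ σ ^ (ℓ ^ k) = 1 := by
  have hcont : Continuous fun g : G => ((ρ g : GL (Fin n) E) : Matrix (Fin n) (Fin n) E) :=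
    Units.continuous_val.comp (map_continuous ρ)
  have hlim : Tendsto (fun k : ℕ => ((ρ σ : GL (Fin n) E) : Matrix (Fin n) (Fin n) E) ^ (ℓ ^ k)) atTop (𝓝 1) := by
    have h1 := (hcont.tendsto 1).comp hσ
    rw [map_one, Units.val_one] at h1
    refine h1.congr fun k => ?_
    simp only [Function.comp_apply, map_pow, Units.val_pow_eq_pow_val]
  obtain ⟨k, hk⟩ := Matrix.exists_pow_prime_pow_eq_one_of_tendsto hℓ hlim
  refine ⟨k, Units.ext ?_⟩
  rw [Units.val_pow_eq_pow_val, hk, Units.val_one]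

/-- **Linear form.**  For a continuous representation `ρ` of `G` on a finite-dimensional `E`-vector space with its module
topology (`E` ultrametric, `‖ℓ‖_E = 1`) and `σ ∈ G` with `σ^{ℓ^k} → 1`: `ρ(σ)^{ℓ^k} = 1` for some `k` (matrix of `ρ` in
a basis; its entries are continuous in `σ`). [cite: Katz1988, Ch. 1, 1.8 and Remark 1.10] -/
theorem ContinuousRep.exists_pow_prime_pow_eq_one_of_tendsto {M : Type*} [AddCommGroup M] [Module E M]
    [TopologicalSpace M] [IsModuleTopology E M] [FiniteDimensional E M] (ρ : ContinuousRep G E M) {ℓ : ℕ}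
    (hℓ : ‖(ℓ : E)‖ = 1) {σ : G} (hσ : Tendsto (fun k : ℕ => σ ^ (ℓ ^ k)) atTop (𝓝 1)) :
    ∃ k : ℕ, (ρ σ : M →ₗ[E] M) ^ (ℓ ^ k) = 1 := by
  classical
  set b := Module.finBasis E M with hb
  haveI : ContinuousAdd M := IsModuleTopology.toContinuousAdd E M
  let Φ : G →* Matrix (Fin (finrank E M)) (Fin (finrank E M)) E :=
    { toFun := fun g => LinearMap.toMatrix b b (ρ g)
      map_one' := by rw [map_one, Module.End.one_eq_id, LinearMap.toMatrix_id]
      map_mul' := fun g h => by rw [map_mul, Module.End.mul_eq_comp, LinearMap.toMatrix_comp b b b] }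
  have hΦ : ∀ g, Φ g = LinearMap.toMatrix b b (ρ g) := fun g => rfl
  have hΦcont : Continuous Φ := by
    refine continuous_matrix fun i j => ?_
    simp only [hΦ, LinearMap.toMatrix_apply]
    exact (IsModuleTopology.continuous_of_linearMap (b.coord i)).comp (ρ.continuous_apply_left (b j))
  have hlim : Tendsto (fun k : ℕ => Φ σ ^ (ℓ ^ k)) atTop (𝓝 1) := by
    have h1 := (hΦcont.tendsto 1).comp hσ
    rw [map_one] at h1
    refine h1.congr fun k => ?_
    simp only [Function.comp_apply, map_pow]
  obtain ⟨k, hk⟩ := Matrix.exists_pow_prime_pow_eq_one_of_tendsto hℓ hlim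
  refine ⟨k, (LinearMap.toMatrix b b).injective ?_⟩
  rw [← map_pow, hΦ, map_pow] at hk
  rw [hk, Module.End.one_eq_id, LinearMap.toMatrix_id]

end Representations

/-! ### Galois representations: ramification groups `Γ_K^u`, `u > 0`, at `𝔓 ∋ ℓ` -/

section Galois

variable {K : Type} [Field K] [NumberField K] {E : Type*} [NormedField E] [IsUltrametricDist E]

/-- An element of `Γ_K^u`, `u > 0`, lies in the wild closure at `𝔓`, hence `σ^{ℓ^k} → 1` for the residue
characteristic `ℓ ∈ 𝔓` (the tree's `GaloisRep.tendsto_pow_pow_of_mem_closure`).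
[cite: SerreLocalFields1979, Ch. IV §2, Cor. 3 of Prop. 7] -/
theorem tendsto_pow_prime_pow_of_mem_absUpperRamificationSubgroup (𝔓 : Ideal (absIntegers (𝓞 K) K))
    [𝔓.IsPrime] {ℓ : ℕ} (hℓ𝔓 : ((ℓ : ℕ) : absIntegers (𝓞 K) K) ∈ 𝔓) {u : ℝ} (hu : 0 < u)
    {σ : Field.absoluteGaloisGroup K} (hσ : σ ∈ absUpperRamificationSubgroup (𝓞 K) 𝔓 u) :
    Tendsto (fun k : ℕ => σ ^ (ℓ ^ k)) atTop (𝓝 1) :=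
  GaloisRep.tendsto_pow_pow_of_mem_closure (𝓞 K) 𝔓 hℓ𝔓
    (Subgroup.le_topologicalClosure _ (Subgroup.subset_closure ⟨u, hu, hσ⟩))

/-- **Framed Galois form.**  For a continuous `ρ : Γ_K →ₜ* GL_n(E)` over an ultrametric normed field `E` with
`‖ℓ‖_E = 1`, every `σ ∈ Γ_K^u`, `u > 0`, at a prime `𝔓 ∋ ℓ` has `ρ(σ)^{ℓ^k} = 1` for some `k`.
[cite: Katz1988, Ch. 1, 1.8 and Remark 1.10] -/
theorem FramedGaloisRep.exists_pow_prime_pow_eq_one_of_mem_absUpperRamificationSubgroup {n : ℕ}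
    (ρ : FramedGaloisRep K E n) (𝔓 : Ideal (absIntegers (𝓞 K) K)) [𝔓.IsPrime] {ℓ : ℕ}
    (hℓ𝔓 : ((ℓ : ℕ) : absIntegers (𝓞 K) K) ∈ 𝔓) (hℓ : ‖(ℓ : E)‖ = 1) {u : ℝ} (hu : 0 < u)
    {σ : Field.absoluteGaloisGroup K} (hσ : σ ∈ absUpperRamificationSubgroup (𝓞 K) 𝔓 u) :
    ∃ k : ℕ, ρ σ ^ (ℓ ^ k) = 1 :=
  FramedRep.exists_pow_prime_pow_eq_one_of_tendsto ρ hℓ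
    (tendsto_pow_prime_pow_of_mem_absUpperRamificationSubgroup 𝔓 hℓ𝔓 hu hσ)

/-- **Linear Galois form.**  For a continuous representation `ρ` of `Γ_K` on a finite-dimensional `E`-vector space with
its module topology (`E` ultrametric, `‖ℓ‖_E = 1`), every `σ ∈ Γ_K^u`, `u > 0`, at a prime `𝔓 ∋ ℓ` has
`ρ(σ)^{ℓ^k} = 1` for some `k`. [cite: Katz1988, Ch. 1, 1.8 and Remark 1.10] -/
theorem GaloisRep.exists_pow_prime_pow_eq_one_of_mem_absUpperRamificationSubgroup {M : Type*} [AddCommGroup M]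
    [Module E M] [TopologicalSpace M] [IsModuleTopology E M] [FiniteDimensional E M] (ρ : GaloisRep K E M)
    (𝔓 : Ideal (absIntegers (𝓞 K) K)) [𝔓.IsPrime] {ℓ : ℕ} (hℓ𝔓 : ((ℓ : ℕ) : absIntegers (𝓞 K) K) ∈ 𝔓)
    (hℓ : ‖(ℓ : E)‖ = 1) {u : ℝ} (hu : 0 < u) {σ : Field.absoluteGaloisGroup K}
    (hσ : σ ∈ absUpperRamificationSubgroup (𝓞 K) 𝔓 u) :
    ∃ k : ℕ, (ρ σ : M →ₗ[E] M) ^ (ℓ ^ k) = 1 :=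
  ContinuousRep.exists_pow_prime_pow_eq_one_of_tendsto ρ hℓ
    (tendsto_pow_prime_pow_of_mem_absUpperRamificationSubgroup 𝔓 hℓ𝔓 hu hσ)

end Galois

/-! ### The dichotomy of brick LM-B with element-dependent exponent -/

section Dichotomy

variable {G : Type*} [Group G] [TopologicalSpace G] {A : Type*} [Field A] [TopologicalSpace A]

/-- **DICHOTOMY, linear form, element-dependent exponent.**  For a continuous representation `ρ` of `G` on a
`2`-dimensional `A`-vector space and a subgroup `H` on which every `ρ(h)` has determinant `1` and finite order prime
to the characteristic (`ρ(h)^N = 1`, `(N : A) ≠ 0`, `N` depending on `h`): the `H`-fixed submodule is `⊥` or `⊤`.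
[folklore] -/
theorem ContinuousRep.fixedSubmodule_eq_bot_or_eq_top_of_forall_exists_pow {M : Type*} [AddCommGroup M]
    [Module A M] [TopologicalSpace M] (ρ : ContinuousRep G A M) (h2 : finrank A M = 2) (H : Subgroup G)
    (hpow : ∀ h ∈ H, ∃ N : ℕ, (N : A) ≠ 0 ∧ (ρ h : M →ₗ[A] M) ^ N = 1)
    (hdet : ∀ h ∈ H, LinearMap.det (ρ h : M →ₗ[A] M) = 1) :
    ρ.fixedSubmodule H = ⊥ ∨ ρ.fixedSubmodule H = ⊤ := by
  by_cases hbot : ρ.fixedSubmodule H = ⊥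
  · exact Or.inl hbot
  · right
    obtain ⟨v, hvmem, hv⟩ := (Submodule.ne_bot_iff _).mp hbot
    refine ρ.fixedSubmodule_eq_top_of_forall_eq_one fun h hh => ?_
    obtain ⟨N, hN, hpowh⟩ := hpow h hh
    exact LinearMap.eq_one_of_apply_eq_of_det_eq_one_of_pow_eq_one h2 _ hv
      ((ρ.mem_fixedSubmodule H v).mp hvmem h hh) (hdet h hh) hN hpowh

variable [IsTopologicalRing A]

/-- **DICHOTOMY, framed form, element-dependent exponent.**  For `ρ : G →ₜ* GL₂(A)` and a subgroup `H` on which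
`det ρ = 1` and every `ρ(h)` has finite order prime to the characteristic: the `H`-fixed submodule of `A²` is `⊥` or
`⊤`. [folklore] -/
theorem FramedRep.fixedSubmodule_eq_bot_or_eq_top_of_forall_exists_pow (ρ : FramedRep G A 2) (H : Subgroup G)
    (hpow : ∀ h ∈ H, ∃ N : ℕ, (N : A) ≠ 0 ∧ ρ h ^ N = 1)
    (hdet : ∀ h ∈ H, Matrix.GeneralLinearGroup.det (ρ h) = 1) :
    ρ.toContinuousRep.fixedSubmodule H = ⊥ ∨ ρ.toContinuousRep.fixedSubmodule H = ⊤ := by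
  have h2 : finrank A (Fin 2 → A) = 2 := by simp
  refine ContinuousRep.fixedSubmodule_eq_bot_or_eq_top_of_forall_exists_pow ρ.toContinuousRep h2 H
    (fun h hh => ?_) (fun h hh => ?_)
  · obtain ⟨N, hN, hpowh⟩ := hpow h hh
    refine ⟨N, hN, ?_⟩
    rw [FramedRep.toContinuousRep_apply_eq_toLinAlgEquiv', ← map_pow, ← Units.val_pow_eq_pow_val, hpowh,
      Units.val_one, map_one]
  · rw [FramedRep.toContinuousRep_apply_eq_toLinAlgEquiv']
    have hd : LinearMap.det (Matrix.toLinAlgEquiv' ((ρ h : GL (Fin 2) A) : Matrix (Fin 2) (Fin 2) A)) =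
        ((ρ h : GL (Fin 2) A) : Matrix (Fin 2) (Fin 2) A).det := LinearMap.det_toLin' _
    rw [hd, ← Matrix.GeneralLinearGroup.val_det_apply, hdet h hh, Units.val_one]

end Dichotomy

end Summit.BirchSwinnertonDyer.BirchSwinnertonDyer.Theorems.SmallImageLambdaLowerThreeNsThetaPartner

end
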